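import Literature.MathematicalPhysics.QuantumFieldTheory.Balaban1983to89.Node00.LargeFieldBackgroundCoOfRecord
import Literature.MathematicalPhysics.QuantumFieldTheory.Balaban1983to89.Node00.Record12MinimiserSelection
import Literature.MathematicalPhysics.QuantumFieldTheory.Balaban1983to89.Node00.TkNoExpansionStepZero

/-!
# NODE 00 (definitions of record, R-side ₇, FILE 22b) — the structure faces of print's full class named «on ask» in the API PARITY TABLE
# FILE 16 ↦ FILE 22 (director-ym №152 §3; desk `PARITY-16-22.md` tables B, C(3)), and the FULL-CLASS background at the all-large-field sequence
# (asked by name: dag-n11-e g7, pub-ymgap INBOX 2026-08-27T08:48:14Z — the Co twin of n11's `UbgMSOfRecord_one_of_Omega_empty`)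

§1 HELPERS (kernel bookkeeping): `plaqsOf_empty`, `coDivSmallOn_empty`, `plaqSmallOn_empty`, `omegaBonds_zero` (`Ω₀ = T_η`: at scale `0` every bond counts),
`omegaBonds_succ` (`bondsOf_empty` is `Node00/Record12MinimiserSelection` :169, cited by name.)

§2 THE STRUCTURE FACES OF PRINT'S FULL CLASS `regMSCoOfRecord` (FILE 22, [6] (1.7) ∧ (1.9) = [15] (2)): `regMSCoOfRecord_zero_eq` (length 0: the full class = FILE 13's one-scale class CUT by the global scale-`0` co-divergence clause — NOT equal to it),
`regMSCoOfRecord_succ_eq_of_Omega_empty` (a no-expansion step `Ω_{k+1} = ∅` adds only vacuous clauses; generic in the two sequences, so n11's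
`s.init` instance is one application), `mem_regMSCoOfRecord_one_iff_of_Omega_empty` (the base case `k = 1`, `Ω₁ = ∅`: GLOBAL (1.7) at `εreg·η₀²` AND GLOBAL
(1.9) at `εreg·η₀³` — print's `Ω₀ = T_η` carries both, [6] (1.7),(1.9) p.77 at `j = 0`).

§3 THE FULL-CLASS BACKGROUND OF RECORD `UbgMSCoOfRecord` (FILE 22) AT A LENGTH-1 SEQUENCE WITH `Ω₁ = ∅`: by n11's generic `isMinimizer_genSet_one_iff_of_Omega_empty`
(`Node00/TkNoExpansionStepZero`, generic in the class) the (2.12) constraint set there is the singleton `{𝐖 0}`, so the solvable set is read AT THE DATUM: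
`mem_solvableDom_regMSCo_genSet_one_iff_of_Omega_empty` (`𝐖` solvable ↔ `𝐖 0 ∈ U_1({Ω_j}, εreg)` ↔ GLOBAL (1.7) ∧ GLOBAL scale-`0` (1.9) at `𝐖 0`),
`UbgMSCoOfRecord_one_of_Omega_empty[_of_mem]` (`U_1(s′)(𝐖) = 𝐖 0` ON THAT CLASS) and `UbgMSCoOfRecord_one_of_Omega_empty_of_not[_mem]` (`= fun _ => 1` OFF it).
DELTA AGAINST THE (1.7)-EDITION (n11's `UbgMSOfRecord_one_of_Omega_empty`, hypothesis `PlaqSmall (εreg·η₀²) (𝐖 0)` only): the full-class background returns the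
datum only under the ADDITIONAL global scale-`0` co-divergence clause `Sect2.CoDivSmallOn univ (εreg·η₀³) (𝐖 0)`; a plaquette-regular but co-divergence-rough
`𝐖 0` is OFF the solvable set and gets the junk unit configuration — the p. 256 regularity function of the step weights (`chiRegW`, plaquettes only) does NOT
supply that clause.  Bookkeeping over landed definitions; nothing of Bałaban asserted ([15] Thm 1 existence NOT used: at `Ω₁ = ∅` the minimiser is forced).
[cite: Balaban1985RegularSpaces, (1.3),(1.7),(1.9) p.77; Balaban1985Variational, (2),(6) p.278, Thm 1 (8) p.279; Balaban1988Convergent, (2.2) p.255, (2.10)–(2.13) pp.256–257]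
-/

noncomputable section

namespace Literature.MathematicalPhysics.QuantumFieldTheory.Balaban1983to89.Node00

open Literature.MathematicalPhysics.QuantumFieldTheory.Balaban1983to89
open T4Continuum B15DeterminingSets

section Helpers

variable {P : Params} {N : ℕ} [NeZero N] {j : ℕ}

/-- [B8]'s plaquette set of the empty region is empty. [cite: Balaban1985RegularSpaces, p.77 (convention before (1.5); bookkeeping)] -/
theorem plaqsOf_empty : B8Eq17ClassAkV1.plaqsOf (∅ : Set (Site P j)) = ∅ :=
  Set.eq_empty_of_forall_notMem fun _ h => by
    rcases h with h | h | h | h <;> exact h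

/-- The co-divergence clause on the empty bond set is vacuous. [cite: Balaban1985RegularSpaces, (1.9) p.77 (bookkeeping)] -/
theorem coDivSmallOn_empty (δ : ℝ) (U : GaugeField P j (SU N)) : Sect2.CoDivSmallOn (∅ : Set (PBond P j)) δ U :=
  fun _ h => h.elim

/-- The plaquette clause on the empty plaquette set is vacuous. [cite: Balaban1985RegularSpaces, (1.7) p.77 (bookkeeping)] -/
theorem plaqSmallOn_empty (δ : ℝ) (U : GaugeField P j (SU N)) : PlaqSmallOn (∅ : Set (Plaq P j)) δ U :=
  fun _ h => h.elim

/-- At scale `0` every bond counts (`Ω₀ = T_η`; def-P11's `Sect2.omegaBonds`). [cite: Balaban1985RegularSpaces, (1.3) p.77] -/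
theorem omegaBonds_zero (Ω : ℕ → Set (Site P 0)) : Sect2.omegaBonds Ω 0 = Set.univ := if_pos rfl

/-- At a positive scale (successor form): the bonds meeting `Ω_{j+1}`. [cite: Balaban1985RegularSpaces, (1.9) p.77] -/
theorem omegaBonds_succ (Ω : ℕ → Set (Site P 0)) (j : ℕ) : Sect2.omegaBonds Ω (j + 1) = bondsOf (Ω (j + 1)) := if_neg (Nat.succ_ne_zero j)

end Helpers

variable (F : T4Family) (N : ℕ) [NeZero N]

/-- **LENGTH 0**: print's full class at `k = 0` is FILE 13's one-scale class `regLFOfRecord … 0` (global (1.7) at `εreg·η₀²`, FILE 16 `regMSOfRecord_zero_eq`)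
CUT by the global scale-`0` co-divergence clause — strictly smaller in general (PARITY table C(3): no `_zero_eq` twin onto `regLFOfRecord`).
[cite: Balaban1985RegularSpaces, (1.7),(1.9) p.77 (j = 0); Balaban1985Variational, (2) p.278] -/
theorem regMSCoOfRecord_zero_eq (ν : Stage7Numerics) (K : ℕ) (Ω : ℕ → Set (Site (F.P K) 0)) :
    regMSCoOfRecord F N ν K 0 Ω = regLFOfRecord F N ν K 0 ∩ {U | Sect2.CoDivSmallOn Set.univ (ν.εreg * (F.P K).eta 0 ^ 3) U} := by
  ext U
  rw [regMSCoOfRecord_eq_inter, regMSOfRecord_zero_eq]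
  simp only [Set.mem_inter_iff, Set.mem_setOf_eq, and_congr_right_iff]
  intro _
  constructor
  · intro h9
    simpa only [omegaBonds_zero, pow_zero] using h9 0 le_rfl
  · intro h9 j hj
    obtain rfl := Nat.le_zero.mp hj
    simpa only [omegaBonds_zero] using h9

variable {F N}

/-- **A NO-EXPANSION STEP ADDS ONLY VACUOUS CLAUSES**: if `Ω_{k+1} = ∅` and `Ω'` agrees with `Ω` up to scale `k`, print's full class of length `k+1` for `Ω`
is the length-`k` class for `Ω'` (n11's `regMSOfRecord_succ_eq_init_of_Omega_empty` shape, with `Ω' := s.init.Ω`; PARITY table B).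
[cite: Balaban1985RegularSpaces, (1.7),(1.9) p.77; Balaban1988Convergent, (2.12) p.256] -/
theorem regMSCoOfRecord_succ_eq_of_Omega_empty (ν : Stage7Numerics) (K k : ℕ) {Ω Ω' : ℕ → Set (Site (F.P K) 0)}
    (hΩ : Ω (k + 1) = ∅) (hagree : ∀ j, 1 ≤ j → j ≤ k → Ω' j = Ω j) :
    regMSCoOfRecord F N ν K (k + 1) Ω = regMSCoOfRecord F N ν K k Ω' := by
  have hΩP : ∀ j, j ≤ k → omegaPlaqs Ω' j = omegaPlaqs Ω j := fun j hj => by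
    rcases Nat.eq_zero_or_pos j with rfl | hpos
    · rfl
    · rw [omegaPlaqs_of_ne_zero Ω' hpos.ne', omegaPlaqs_of_ne_zero Ω hpos.ne', hagree j hpos hj]
  have hΩB : ∀ j, j ≤ k → Sect2.omegaBonds Ω' j = Sect2.omegaBonds Ω j := fun j hj => by
    rcases Nat.eq_zero_or_pos j with rfl | hpos
    · rw [omegaBonds_zero, omegaBonds_zero]
    · obtain ⟨i, rfl⟩ := Nat.exists_eq_succ_of_ne_zero hpos.ne'
      rw [omegaBonds_succ, omegaBonds_succ, hagree (i + 1) hpos hj]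
  ext U
  simp only [regMSCoOfRecord_eq_setOf, Set.mem_setOf_eq, Sect2.CoDivClassOn]
  constructor
  · rintro ⟨h7, h9⟩
    exact ⟨fun j hj => hΩP j hj ▸ h7 j (Nat.le_succ_of_le hj), fun j hj => hΩB j hj ▸ h9 j (Nat.le_succ_of_le hj)⟩
  · rintro ⟨h7, h9⟩
    refine ⟨fun j hj => ?_, fun j hj => ?_⟩
    · rcases Nat.of_le_succ hj with hle | rfl
      · exact hΩP j hle ▸ h7 j hle
      · rw [omegaPlaqs_succ, hΩ, plaqsOf_empty]; exact plaqSmallOn_empty _ _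
    · rcases Nat.of_le_succ hj with hle | rfl
      · exact hΩB j hle ▸ h9 j hle
      · rw [omegaBonds_succ, hΩ, bondsOf_empty]; exact coDivSmallOn_empty _ _

/-- **THE BASE CASE `k = 1`, `Ω₁ = ∅`**: print's full class is GLOBAL (1.7) at `εreg·η₀²` AND GLOBAL (1.9) at `εreg·η₀³` (`Ω₀ = T_η` carries both clauses;
n11's `mem_regMSOfRecord_one_iff_of_Omega_empty` shape plus the co-divergence conjunct; PARITY table B). [cite: Balaban1985RegularSpaces, (1.7),(1.9) p.77 (j = 0)] -/
theorem mem_regMSCoOfRecord_one_iff_of_Omega_empty (ν : Stage7Numerics) (K : ℕ) (Ω : ℕ → Set (Site (F.P K) 0)) (hΩ : Ω 1 = ∅)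
    (U : GaugeField (F.P K) 0 (SU N)) :
    U ∈ regMSCoOfRecord F N ν K 1 Ω ↔
      PlaqSmall (ν.εreg * (F.P K).eta 0 ^ 2) U ∧ Sect2.CoDivSmallOn Set.univ (ν.εreg * (F.P K).eta 0 ^ 3) U := by
  rw [regMSCoOfRecord_succ_eq_of_Omega_empty ν K 0 (Ω := Ω) (Ω' := fun _ => ∅) hΩ (fun j h1 h0 => (Nat.not_succ_le_zero 0 (h1.trans h0)).elim),
    regMSCoOfRecord_zero_eq]
  simp only [Set.mem_inter_iff, Set.mem_setOf_eq, mem_regLFOfRecord_iff]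

section BackgroundAtAllLarge

/-- **THE SOLVABLE SET AT `Ω₁ = ∅`, READ AT THE DATUM**: for a length-`1` sequence of regions with no small-field region (`Γ₀ = T`, `Γ₁ = ∅`, (2.2)) the
(2.12) constraint set is the singleton `{𝐖 0}` (n11's `isMinimizer_genSet_one_iff_of_Omega_empty`, generic in the class), so a minimal configuration over
print's FULL class exists iff the scale-`0` datum itself lies in `U_1({Ω_j}, εreg)`. [cite: Balaban1988Convergent, (2.2) p.255, (2.12) p.256; Balaban1985Variational, (6) p.278] -/
theorem mem_solvableDom_regMSCo_genSet_one_iff_of_Omega_empty (ν : Stage7Numerics) (K : ℕ) (Ω : ℕ → Set (Site (F.P K) 0)) (hΩ : Ω 1 = ∅)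
    (W : MSField (F.P K) (SU N)) :
    W ∈ solvableDom (avOfRecord F N K) (regMSCoOfRecord F N ν K 1 Ω) (genSet Ω 1) ↔ W 0 ∈ regMSCoOfRecord F N ν K 1 Ω := by
  rw [mem_solvableDom_iff]
  constructor
  · rintro ⟨U₀, hU₀⟩
    exact ((isMinimizer_genSet_one_iff_of_Omega_empty _ _ Ω hΩ W U₀).1 hU₀).2
  · intro h
    exact ⟨W 0, (isMinimizer_genSet_one_iff_of_Omega_empty _ _ Ω hΩ W (W 0)).2 ⟨rfl, h⟩⟩

/-- The same solvability criterion with print's full class at `Ω₁ = ∅` DISPLAYED: GLOBAL (1.7) at `εreg·η₀²` AND GLOBAL scale-`0` (1.9) at `εreg·η₀³`, both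
read at `𝐖 0`. [cite: Balaban1985RegularSpaces, (1.7),(1.9) p.77 (j = 0); Balaban1985Variational, (2),(6) p.278] -/
theorem mem_solvableDom_regMSCo_genSet_one_iff_of_Omega_empty' (ν : Stage7Numerics) (K : ℕ) (Ω : ℕ → Set (Site (F.P K) 0)) (hΩ : Ω 1 = ∅)
    (W : MSField (F.P K) (SU N)) :
    W ∈ solvableDom (avOfRecord F N K) (regMSCoOfRecord F N ν K 1 Ω) (genSet Ω 1) ↔
      PlaqSmall (ν.εreg * (F.P K).eta 0 ^ 2) (W 0) ∧ Sect2.CoDivSmallOn Set.univ (ν.εreg * (F.P K).eta 0 ^ 3) (W 0) := by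
  rw [mem_solvableDom_regMSCo_genSet_one_iff_of_Omega_empty ν K Ω hΩ, mem_regMSCoOfRecord_one_iff_of_Omega_empty ν K Ω hΩ]

/-- **def-R's FULL-CLASS BACKGROUND OF RECORD AT THE ALL-LARGE-FIELD SEQUENCE IS THE FINE FIELD — ON THE FULL CLASS** (membership form): at `Ω₁(s′) = ∅`,
for a retained configuration `𝐖` whose scale-`0` field lies in `U_1({Ω_j(s′)}, εreg)`, `U_1(s′)(𝐖) = 𝐖 0` — print's `U₁ = V₀` on `Γ₀ = T`; the Co twin
of n11's `UbgMSOfRecord_one_of_Omega_empty` (FILE 16 edition) for FILE 22's `UbgMSCoOfRecord`; no minimisation is left, so [15] Thm 1 is not invoked.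
[cite: Balaban1988Convergent, (2.12)–(2.13) pp.256–257, Thm 1 p.262; Balaban1985Variational, Thm 1 (8) p.279] -/
theorem UbgMSCoOfRecord_one_of_Omega_empty_of_mem (ν : Stage7Numerics) (M : ℕ) (g : ℕ → ℝ) (K : ℕ) (s : SeqOfRecord F ν M g K 1)
    (hΩ : s.Ω 1 = ∅) (W : MSField (F.P K) (SU N)) (hW : W 0 ∈ regMSCoOfRecord F N ν K 1 s.Ω) :
    UbgMSCoOfRecord F N ν M g K 1 s W = W 0 := by
  have hex : ∃ U₀, IsMinimizer (avOfRecord F N K) (regMSCoOfRecord F N ν K 1 s.Ω) (genSet s.Ω 1) W U₀ :=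
    ⟨W 0, (isMinimizer_genSet_one_iff_of_Omega_empty _ _ s.Ω hΩ W (W 0)).2 ⟨rfl, hW⟩⟩
  rw [UbgMSCoOfRecord_apply]
  exact ((isMinimizer_genSet_one_iff_of_Omega_empty _ _ s.Ω hΩ W _).1
    (isMinimizer_UminOfRecord (avOfRecord F N K) (regMSCoOfRecord F N ν K 1 s.Ω) hex)).1

/-- **… WITH THE CLASS DISPLAYED**: `U_1(s′)(𝐖) = 𝐖 0` for a scale-`0` field that is GLOBALLY (1.7)-small at `εreg·η₀²` AND GLOBALLY (1.9)-small at
`εreg·η₀³` (the second hypothesis is the delta against the (1.7)-edition `UbgMSOfRecord_one_of_Omega_empty`).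
[cite: Balaban1985RegularSpaces, (1.7),(1.9) p.77 (j = 0); Balaban1988Convergent, (2.12) p.256, Thm 1 p.262] -/
theorem UbgMSCoOfRecord_one_of_Omega_empty (ν : Stage7Numerics) (M : ℕ) (g : ℕ → ℝ) (K : ℕ) (s : SeqOfRecord F ν M g K 1) (hΩ : s.Ω 1 = ∅)
    (W : MSField (F.P K) (SU N)) (hW : PlaqSmall (ν.εreg * (F.P K).eta 0 ^ 2) (W 0))
    (hW9 : Sect2.CoDivSmallOn Set.univ (ν.εreg * (F.P K).eta 0 ^ 3) (W 0)) : UbgMSCoOfRecord F N ν M g K 1 s W = W 0 :=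
  UbgMSCoOfRecord_one_of_Omega_empty_of_mem ν M g K s hΩ W ((mem_regMSCoOfRecord_one_iff_of_Omega_empty ν K s.Ω hΩ _).2 ⟨hW, hW9⟩)

/-- … and OFF the full class at the datum it is the junk unit configuration (the solvable set is empty there: FILE 1's totalisation; membership form).
[cite: Balaban1988Convergent, (2.12) p.256 (typing convention)] -/
theorem UbgMSCoOfRecord_one_of_Omega_empty_of_not_mem (ν : Stage7Numerics) (M : ℕ) (g : ℕ → ℝ) (K : ℕ) (s : SeqOfRecord F ν M g K 1)
    (hΩ : s.Ω 1 = ∅) (W : MSField (F.P K) (SU N)) (hW : W 0 ∉ regMSCoOfRecord F N ν K 1 s.Ω) :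
    UbgMSCoOfRecord F N ν M g K 1 s W = fun _ => 1 :=
  UbgMSCoOfRecord_of_not_mem ν M g K 1 s (by rwa [mem_solvableDom_regMSCo_genSet_one_iff_of_Omega_empty ν K s.Ω hΩ])

/-- … in particular for a scale-`0` field that is NOT (globally (1.7)-small ∧ globally (1.9)-small) — e.g. a plaquette-regular, co-divergence-rough `𝐖 0`,
which the p. 256 regularity function of the step weights does not exclude. [cite: Balaban1988Convergent, (2.10) p.256, (2.12) p.256 (typing convention)] -/
theorem UbgMSCoOfRecord_one_of_Omega_empty_of_not (ν : Stage7Numerics) (M : ℕ) (g : ℕ → ℝ) (K : ℕ) (s : SeqOfRecord F ν M g K 1)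
    (hΩ : s.Ω 1 = ∅) (W : MSField (F.P K) (SU N))
    (hW : ¬ (PlaqSmall (ν.εreg * (F.P K).eta 0 ^ 2) (W 0) ∧ Sect2.CoDivSmallOn Set.univ (ν.εreg * (F.P K).eta 0 ^ 3) (W 0))) :
    UbgMSCoOfRecord F N ν M g K 1 s W = fun _ => 1 :=
  UbgMSCoOfRecord_one_of_Omega_empty_of_not_mem ν M g K s hΩ W (by rwa [mem_regMSCoOfRecord_one_iff_of_Omega_empty ν K s.Ω hΩ])

/-- The two cases together: at `Ω₁ = ∅` the full-class background is the datum or the unit configuration, decided by full-class membership of `𝐖 0`.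
[cite: Balaban1988Convergent, (2.12) p.256 (bookkeeping)] -/
theorem UbgMSCoOfRecord_one_eq_ite_of_Omega_empty (ν : Stage7Numerics) (M : ℕ) (g : ℕ → ℝ) (K : ℕ) (s : SeqOfRecord F ν M g K 1)
    (hΩ : s.Ω 1 = ∅) (W : MSField (F.P K) (SU N)) [Decidable (W 0 ∈ regMSCoOfRecord F N ν K 1 s.Ω)] :
    UbgMSCoOfRecord F N ν M g K 1 s W = if W 0 ∈ regMSCoOfRecord F N ν K 1 s.Ω then W 0 else fun _ => 1 := by
  split_ifs with h
  · exact UbgMSCoOfRecord_one_of_Omega_empty_of_mem ν M g K s hΩ W h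
  · exact UbgMSCoOfRecord_one_of_Omega_empty_of_not_mem ν M g K s hΩ W h

/-- Containment of record at `Ω₁ = ∅`: where the FULL-CLASS background returns the datum, so does the (1.7)-edition background (`regMSCoOfRecord ⊆ regMSOfRecord`);
the converse fails off the scale-`0` co-divergence class. [cite: Balaban1985RegularSpaces, (1.7),(1.9) p.77; Balaban1988Convergent, (2.12) p.256] -/
theorem UbgMSOfRecord_one_eq_UbgMSCoOfRecord_one_of_Omega_empty_of_mem (ν : Stage7Numerics) (M : ℕ) (g : ℕ → ℝ) (K : ℕ) (s : SeqOfRecord F ν M g K 1)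
    (hΩ : s.Ω 1 = ∅) (W : MSField (F.P K) (SU N)) (hW : W 0 ∈ regMSCoOfRecord F N ν K 1 s.Ω) :
    UbgMSOfRecord F N ν M g K 1 s W = UbgMSCoOfRecord F N ν M g K 1 s W := by
  rw [UbgMSCoOfRecord_one_of_Omega_empty_of_mem ν M g K s hΩ W hW,
    UbgMSOfRecord_one_of_Omega_empty ν M g K s hΩ W ((mem_regMSCoOfRecord_one_iff_of_Omega_empty ν K s.Ω hΩ _).1 hW).1]

end BackgroundAtAllLarge

end Literature.MathematicalPhysics.QuantumFieldTheory.Balaban1983to89.Node00
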